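import Mathlib.Analysis.Calculus.BumpFunction.FiniteDimension
import Mathlib.Analysis.Calculus.FDeriv.CompCLM
import Mathlib.Analysis.Normed.Group.Bounded
import Mathlib.Analysis.Complex.Basic
import Mathlib.LinearAlgebra.Complex.FiniteDimensional
import Mathlib.MeasureTheory.Measure.Lebesgue.Complex
import Mathlib.MeasureTheory.Measure.Lebesgue.EqHaar
import Mathlib.MeasureTheory.Integral.Bochner.Set
import Literature.Geometry.GeometricMeasureTheory.CurrentsEuclideanCycle
import HarnessLib

/-!
# A non-negative exact density on `ℂ` with quadratically decaying primitive vanishes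

Topic `Literature/Geometry/Symplectic`; the planar (chart-level) Stokes step of the energy
argument for `J`-holomorphic spheres (McDuff–Salamon, *Introduction to Symplectic Topology*,
3rd ed. (2017), §4.5, energy identity (4.5.4)), consumed by `ExactNoJSpheres.lean`
(`Literature.Geometry.Symplectic.jSphere_const_of_exact_tame`: an exact tame almost complex
manifold contains no `J`-holomorphic sphere) and, through it, by the hypothesis
"holomorphically aspherical" of Eliashberg (1990), Thm. 5.1 for Stein domains
(`SteinFillingSphereProofs.lean`).  Everything is proved; no definitions, no named facts.

* `extDeriv_apply_vec₂`, `extDeriv_smul_apply_vec₂` — Mathlib's `extDeriv` of a `1`-form on `ℂ`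
  on a pair of vectors, and the Leibniz rule `d(c β) = c dβ + dc ∧ β` in that normalisation;
* `contDiff_extDeriv` — `d` of a `C^∞` form is `C^∞`;
* `clm_eq_zero_of_apply_one_of_apply_I` — a real-linear map on `ℂ` killing `1` and `i` is `0`;
* `extDeriv_apply_eq_zero_of_nonneg_of_decay` — **the decay lemma**: if `β` is a `C^∞` `1`-form
  on `ℂ` with `|β_z(w)| ≤ C ‖w‖ / ‖z‖²` for `‖z‖ ≥ 1` and `dβ(1, i) ≥ 0` everywhere, then
  `dβ(1, i) = 0` everywhere.  Proof: Stokes for the compactly supported form `χ_R β`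
  (`χ_R(z) = χ(z/R)`, `χ` a `ContDiffBump`; the tree's
  `Literature.Geometry.GeometricMeasureTheory.integral_extDeriv_apply_eq_zero`, i.e. `∂𝐄² = 0`)
  gives `∫_{‖z‖≤r} dβ(1,i) ≤ ∫ χ_R dβ(1,i) = -∫ (dχ_R ∧ β)(1,i) ≤ 8 C_χ C V / R → 0`, and a
  continuous non-negative function with vanishing integrals over all discs is zero.

## References

* D. McDuff, D. Salamon, *Introduction to Symplectic Topology*, 3rd ed., OUP (2017), §4.5,
  eq. (4.5.4) (energy identity). [McDuffSalamon2017]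
-/

noncomputable section

open scoped ContDiff Topology
open Set Filter MeasureTheory Metric

namespace Literature.Geometry.Symplectic

/-! ### Flat calculus of `1`-forms on `ℂ` -/

section Flat

/-- `Fin.removeNth 1 (a, b) = (a)` (the companion of Mathlib's `Fin.removeNth_zero`). [folklore] -/
theorem removeNth_one_vec₂ (a b : ℂ) : Fin.removeNth 1 ![a, b] = ![a] := by
  funext j
  fin_cases j
  rfl

/-- Mathlib's exterior derivative of a `1`-form on `ℂ` on a pair of vectors:
`dβ(a, b) = Dβ(a)(b) - Dβ(b)(a)`. [folklore] -/
theorem extDeriv_apply_vec₂ {β : ℂ → ℂ [⋀^Fin 1]→L[ℝ] ℝ} {z : ℂ} (hβ : DifferentiableAt ℝ β z)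
    (a b : ℂ) : extDeriv β z ![a, b] = fderiv ℝ β z a ![b] - fderiv ℝ β z b ![a] := by
  rw [extDeriv_apply hβ, Fin.sum_univ_succ, Fin.sum_univ_one]
  simp [fderiv_continuousAlternatingMap_apply_const_apply hβ, removeNth_one_vec₂, sub_eq_add_neg]

/-- **Leibniz rule for `d` on `ℂ`, degree one**: for a scalar function `c` and a `1`-form `β`,
`d(c β)(a, b) = c · dβ(a, b) + (dc ∧ β)(a, b)` with `(dc ∧ β)(a, b) = dc(a) β(b) - dc(b) β(a)`
(Mathlib's normalisation of `extDeriv`). [folklore] -/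
theorem extDeriv_smul_apply_vec₂ {c : ℂ → ℝ} {β : ℂ → ℂ [⋀^Fin 1]→L[ℝ] ℝ} {z : ℂ}
    (hc : DifferentiableAt ℝ c z) (hβ : DifferentiableAt ℝ β z) (a b : ℂ) :
    extDeriv (fun y => c y • β y) z ![a, b] =
      c z * extDeriv β z ![a, b] + (fderiv ℝ c z a * β z ![b] - fderiv ℝ c z b * β z ![a]) := by
  have hcβ : DifferentiableAt ℝ (fun y => c y • β y) z := hc.smul hβ
  rw [extDeriv_apply_vec₂ hcβ, extDeriv_apply_vec₂ hβ]
  have e : ∀ (m : ℂ) (w : Fin 1 → ℂ), fderiv ℝ (fun y => c y • β y) z m w =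
      c z * fderiv ℝ β z m w + fderiv ℝ c z m * β z w := by
    intro m w
    rw [← fderiv_continuousAlternatingMap_apply_const_apply hcβ]
    have h : (fun y => (c y • β y) w) = fun y => c y * β y w := by
      funext y
      simp
    rw [h, fderiv_fun_mul hc (hβ.continuousAlternatingMap_apply_const w)]
    simp [fderiv_continuousAlternatingMap_apply_const_apply hβ, mul_comm]
  rw [e, e]
  ring

/-- The exterior derivative of a `C^∞` form on `ℂ` is `C^∞` (`d = alternatize ∘ D`). [folklore] -/
theorem contDiff_extDeriv {β : ℂ → ℂ [⋀^Fin 1]→L[ℝ] ℝ} (hβ : ContDiff ℝ ∞ β) :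
    ContDiff ℝ ∞ (extDeriv β) := by
  show ContDiff ℝ ∞ fun x =>
    ContinuousAlternatingMap.alternatizeUncurryFinCLM ℝ ℂ ℝ (fderiv ℝ β x)
  exact (ContinuousAlternatingMap.alternatizeUncurryFinCLM ℝ ℂ ℝ).contDiff.comp
    (hβ.fderiv_right (m := ∞) (by simp))

/-- A real-linear map on `ℂ` vanishing on `1` and `i` vanishes. [folklore] -/
theorem clm_eq_zero_of_apply_one_of_apply_I {F : Type*} [AddCommGroup F] [Module ℝ F]
    [TopologicalSpace F] (L : ℂ →L[ℝ] F) (h1 : L 1 = 0) (hI : L Complex.I = 0) : L = 0 := by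
  ext ζ
  have hζ : ζ = (ζ.re : ℝ) • (1 : ℂ) + (ζ.im : ℝ) • Complex.I := by
    rw [Complex.real_smul, Complex.real_smul, mul_one]
    exact (Complex.re_add_im ζ).symm
  rw [hζ, map_add, map_smul, map_smul, h1, hI, smul_zero, smul_zero, add_zero]
  rfl

/-- **A non-negative exact density with quadratic decay vanishes.**  Let `β` be a `C^∞` `1`-form on
`ℂ` with `|β_z(w)| ≤ C ‖w‖ / ‖z‖²` for `‖z‖ ≥ 1`, and suppose `dβ(1, i) ≥ 0` everywhere.  Then
`dβ(1, i) = 0` everywhere: by Stokes for the compactly supported form `χ_R β`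
(`χ_R(z) = χ(z/R)`, `χ` a bump function), `∫_{‖z‖≤r} dβ(1,i) ≤ ∫ χ_R dβ(1,i) = -∫ (dχ_R ∧ β)(1,i)
≤ 8 C_χ C V / R → 0`, and a continuous non-negative function with vanishing integrals on all discs
is zero.  (The planar Stokes/energy step of McDuff–Salamon (2017), §4.5, (4.5.4).)
[cite: McDuffSalamon2017, §4.5 eq. (4.5.4)] -/
theorem extDeriv_apply_eq_zero_of_nonneg_of_decay {β : ℂ → ℂ [⋀^Fin 1]→L[ℝ] ℝ}
    (hβ : ContDiff ℝ ∞ β) {C : ℝ}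
    (hC : ∀ z : ℂ, 1 ≤ ‖z‖ → ∀ w : ℂ, |β z ![w]| ≤ C * ‖w‖ / ‖z‖ ^ 2)
    (hF : ∀ z, 0 ≤ extDeriv β z ![1, Complex.I]) (z₀ : ℂ) :
    extDeriv β z₀ ![1, Complex.I] = 0 := by
  set F : ℂ → ℝ := fun z => extDeriv β z ![1, Complex.I] with hFdef
  -- `F` is continuous
  have hFc : Continuous F :=
    (ContinuousAlternatingMap.apply ℝ ℂ ℝ ![1, Complex.I]).continuous.comp
      (contDiff_extDeriv hβ).continuous
  have hF_int : ∀ s : Set ℂ, IsCompact s → IntegrableOn F s volume := fun s hs =>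
    hFc.continuousOn.integrableOn_compact hs
  -- the constants
  have hC0 : 0 ≤ C := by
    have h := hC 1 (by simp) 1
    have h0 : (0 : ℝ) ≤ |β 1 ![1]| := abs_nonneg _
    simp only [norm_one, mul_one, one_pow, div_one] at h
    linarith
  let χ : ContDiffBump (0 : ℂ) := ⟨1, 2, one_pos, one_lt_two⟩
  obtain ⟨Cχ, hCχ⟩ : ∃ Cχ, ∀ z, ‖fderiv ℝ χ z‖ ≤ Cχ :=
    ((χ.contDiff (n := 1)).continuous_fderiv one_ne_zero).bounded_above_of_compact_support
      (χ.hasCompactSupport.fderiv (𝕜 := ℝ))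
  have hCχ0 : 0 ≤ Cχ := (norm_nonneg _).trans (hCχ 0)
  set V : ℝ := volume.real (ball (0 : ℂ) 1) with hV
  -- key estimate: `∫_{‖z‖ ≤ r} F ≤ 8 Cχ C V / R` for `R ≥ max r 1`
  have key : ∀ r : ℝ, 0 < r → ∀ R : ℝ, max r 1 ≤ R →
      ∫ z in closedBall (0 : ℂ) r, F z ≤ 8 * Cχ * C * V / R := by
    intro r hr R hR
    have hR1 : 1 ≤ R := le_trans (le_max_right _ _) hR
    have hRr : r ≤ R := le_trans (le_max_left _ _) hR
    have hR0 : 0 < R := one_pos.trans_le hR1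
    -- the scaled cut-off `χR z = χ (z / R)`
    set χR : ℂ → ℝ := fun z => χ (R⁻¹ • z) with hχR
    have hχR_smooth : ContDiff ℝ ∞ χR := χ.contDiff.comp (contDiff_const_smul _)
    have hnorm : ∀ z : ℂ, ‖R⁻¹ • z‖ = R⁻¹ * ‖z‖ := fun z => by
      rw [norm_smul, norm_inv, Real.norm_eq_abs, abs_of_pos hR0]
    have hχR_one : ∀ z : ℂ, ‖z‖ ≤ R → χR z = 1 := fun z hz => by
      apply χ.one_of_mem_closedBall
      rw [mem_closedBall_zero_iff, hnorm]
      calc R⁻¹ * ‖z‖ ≤ R⁻¹ * R := by gcongr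
        _ = 1 := inv_mul_cancel₀ hR0.ne'
    have hχR_zero : ∀ z : ℂ, 2 * R ≤ ‖z‖ → χR z = 0 := fun z hz => by
      apply χ.zero_of_le_dist
      rw [dist_zero_right, hnorm]
      show (2 : ℝ) ≤ R⁻¹ * ‖z‖
      rw [le_inv_mul_iff₀ hR0]
      linarith
    have hχR_nonneg : ∀ z, 0 ≤ χR z := fun z => χ.nonneg
    have hχR_fderiv : ∀ z w, fderiv ℝ χR z w = fderiv ℝ χ (R⁻¹ • z) (R⁻¹ • w) := fun z w => by
      have h1 : HasFDerivAt χR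
          ((fderiv ℝ χ (R⁻¹ • z)).comp (R⁻¹ • ContinuousLinearMap.id ℝ ℂ)) z :=
        ((χ.contDiff (n := 1)).differentiable one_ne_zero (R⁻¹ • z)).hasFDerivAt.comp z
          ((hasFDerivAt_id z).const_smul R⁻¹)
      rw [h1.fderiv]
      rfl
    have hχR_fderiv_norm : ∀ z w, ‖fderiv ℝ χR z w‖ ≤ Cχ * R⁻¹ * ‖w‖ := fun z w => by
      rw [hχR_fderiv]
      calc ‖fderiv ℝ χ (R⁻¹ • z) (R⁻¹ • w)‖
          ≤ ‖fderiv ℝ χ (R⁻¹ • z)‖ * ‖R⁻¹ • w‖ := ContinuousLinearMap.le_opNorm _ _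
        _ ≤ Cχ * (R⁻¹ * ‖w‖) := by rw [hnorm]; gcongr; exact hCχ _
        _ = Cχ * R⁻¹ * ‖w‖ := by ring
    have hχR_fderiv_zero : ∀ z : ℂ, ‖z‖ < R → fderiv ℝ χR z = 0 := fun z hz => by
      have h : χR =ᶠ[𝓝 z] fun _ => (1 : ℝ) := by
        filter_upwards [isOpen_ball.mem_nhds (mem_ball_zero_iff.2 hz)] with w hw
        exact hχR_one w (mem_ball_zero_iff.1 hw).le
      rw [h.fderiv_eq, fderiv_const_apply]
    have hχR_fderiv_zero' : ∀ z : ℂ, 2 * R < ‖z‖ → fderiv ℝ χR z = 0 := fun z hz => by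
      have h : χR =ᶠ[𝓝 z] fun _ => (0 : ℝ) := by
        filter_upwards [(isOpen_lt continuous_const continuous_norm).mem_nhds hz] with w hw
        exact hχR_zero w hw.le
      rw [h.fderiv_eq, fderiv_const_apply]
    -- the compactly supported form `χR • β` and Stokes
    set βR : ℂ → ℂ [⋀^Fin 1]→L[ℝ] ℝ := fun z => χR z • β z with hβR
    have hβR_smooth : ContDiff ℝ 1 βR := (hχR_smooth.smul hβ).of_le (by exact_mod_cast le_top)
    have hβR_supp : HasCompactSupport βR := by
      refine HasCompactSupport.intro (isCompact_closedBall (0 : ℂ) (2 * R)) fun z hz => ?_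
      rw [mem_closedBall_zero_iff, not_le] at hz
      simp [hβR, hχR_zero z hz.le]
    have hStokes : ∫ z, extDeriv βR z ![1, Complex.I] = 0 :=
      GeometricMeasureTheory.integral_extDeriv_apply_eq_zero (μ := volume) hβR_smooth hβR_supp _
    -- `d(χR β)(1, i) = χR F + wR`
    set wR : ℂ → ℝ := fun z =>
      fderiv ℝ χR z 1 * β z ![Complex.I] - fderiv ℝ χR z Complex.I * β z ![1] with hwR
    have hexp : ∀ z, extDeriv βR z ![1, Complex.I] = χR z * F z + wR z := fun z =>
      extDeriv_smul_apply_vec₂ (hχR_smooth.differentiable (by simp) z)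
        (hβ.differentiable (by simp) z) 1 Complex.I
    -- integrability
    have hχRF_int : Integrable (fun z => χR z * F z) volume := by
      refine (hχR_smooth.continuous.mul hFc).integrable_of_hasCompactSupport ?_
      refine HasCompactSupport.intro (isCompact_closedBall (0 : ℂ) (2 * R)) fun z hz => ?_
      rw [mem_closedBall_zero_iff, not_le] at hz
      simp [hχR_zero z hz.le]
    have hwR_zero : ∀ z : ℂ, z ∉ closedBall (0 : ℂ) (2 * R) → wR z = 0 := fun z hz => by
      rw [mem_closedBall_zero_iff, not_le] at hz
      simp [hwR, hχR_fderiv_zero' z hz]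
    have hwR_int : Integrable wR volume := by
      have h1 : Continuous fun z => fderiv ℝ χR z := hχR_smooth.continuous_fderiv (by simp)
      have h2 : ∀ w : Fin 1 → ℂ, Continuous fun z => β z w := fun w =>
        (ContinuousAlternatingMap.apply ℝ ℂ ℝ w).continuous.comp hβ.continuous
      have hc : Continuous wR :=
        ((h1.clm_apply continuous_const).mul (h2 _)).sub
          ((h1.clm_apply continuous_const).mul (h2 _))
      exact hc.integrable_of_hasCompactSupport
        (HasCompactSupport.intro (isCompact_closedBall (0 : ℂ) (2 * R)) hwR_zero)
    -- the bound on `wR`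
    have hwR_bound : ∀ z, ‖wR z‖ ≤ 2 * Cχ * C / R ^ 3 := by
      intro z
      by_cases hz : ‖z‖ < R
      · have : wR z = 0 := by simp [hwR, hχR_fderiv_zero z hz]
        rw [this, norm_zero]
        positivity
      · have hz' : R ≤ ‖z‖ := not_lt.1 hz
        have hz1 : 1 ≤ ‖z‖ := hR1.trans hz'
        have hterm : ∀ a b : ℂ, ‖a‖ = 1 → ‖b‖ = 1 →
            ‖fderiv ℝ χR z a * β z ![b]‖ ≤ Cχ * R⁻¹ * (C / R ^ 2) := by
          intro a b ha hb
          rw [norm_mul]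
          have h1 : ‖fderiv ℝ χR z a‖ ≤ Cχ * R⁻¹ := by simpa [ha] using hχR_fderiv_norm z a
          have h2 : ‖β z ![b]‖ ≤ C / R ^ 2 :=
            calc ‖β z ![b]‖ = |β z ![b]| := rfl
              _ ≤ C * ‖b‖ / ‖z‖ ^ 2 := hC z hz1 b
              _ = C / ‖z‖ ^ 2 := by rw [hb, mul_one]
              _ ≤ C / R ^ 2 := by gcongr
          exact mul_le_mul h1 h2 (norm_nonneg _) (by positivity)
        calc ‖wR z‖ ≤ ‖fderiv ℝ χR z 1 * β z ![Complex.I]‖ +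
              ‖fderiv ℝ χR z Complex.I * β z ![1]‖ := norm_sub_le _ _
          _ ≤ Cχ * R⁻¹ * (C / R ^ 2) + Cχ * R⁻¹ * (C / R ^ 2) :=
              add_le_add (hterm _ _ norm_one Complex.norm_I) (hterm _ _ Complex.norm_I norm_one)
          _ = 2 * Cχ * C / R ^ 3 := by field_simp; ring
    -- the integral of `wR`
    have hwR_integral : ‖∫ z, wR z‖ ≤ 8 * Cχ * C * V / R := by
      rw [← setIntegral_eq_integral_of_forall_compl_eq_zero hwR_zero]
      calc ‖∫ z in closedBall (0 : ℂ) (2 * R), wR z‖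
          ≤ (2 * Cχ * C / R ^ 3) * volume.real (closedBall (0 : ℂ) (2 * R)) :=
            norm_setIntegral_le_of_norm_le_const measure_closedBall_lt_top fun z _ => hwR_bound z
        _ = (2 * Cχ * C / R ^ 3) * ((2 * R) ^ 2 * V) := by
            rw [Measure.addHaar_real_closedBall volume (0 : ℂ) (by positivity),
              Complex.finrank_real_complex]
        _ = 8 * Cχ * C * V / R := by field_simp; ring
    -- the chain of (in)equalities
    have h1 : ∫ z in closedBall (0 : ℂ) r, F z = ∫ z in closedBall (0 : ℂ) r, χR z * F z :=
      setIntegral_congr_fun measurableSet_closedBall fun z hz => by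
        rw [hχR_one z ((mem_closedBall_zero_iff.1 hz).trans hRr), one_mul]
    have h2 : ∫ z in closedBall (0 : ℂ) r, χR z * F z ≤ ∫ z, χR z * F z :=
      setIntegral_le_integral hχRF_int (Eventually.of_forall fun z => mul_nonneg (hχR_nonneg z) (hF z))
    have h3 : ∫ z, χR z * F z = -∫ z, wR z := by
      have h : ∫ z, extDeriv βR z ![1, Complex.I] = (∫ z, χR z * F z) + ∫ z, wR z := by
        rw [← integral_add hχRF_int hwR_int]
        exact integral_congr_ae (Eventually.of_forall hexp)
      linarith [hStokes]
    calc ∫ z in closedBall (0 : ℂ) r, F z = ∫ z in closedBall (0 : ℂ) r, χR z * F z := h1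
      _ ≤ ∫ z, χR z * F z := h2
      _ = -∫ z, wR z := h3
      _ ≤ ‖∫ z, wR z‖ := by rw [Real.norm_eq_abs]; exact neg_le_abs _
      _ ≤ 8 * Cχ * C * V / R := hwR_integral
  -- hence `∫_{‖z‖ ≤ r} F = 0` for every `r > 0`
  have hzero : ∀ r : ℝ, 0 < r → ∫ z in closedBall (0 : ℂ) r, F z = 0 := by
    intro r hr
    have ht : Tendsto (fun R : ℝ => 8 * Cχ * C * V / R) atTop (𝓝 0) :=
      tendsto_const_nhds.div_atTop tendsto_id
    have hle : ∫ z in closedBall (0 : ℂ) r, F z ≤ 0 :=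
      ge_of_tendsto ht (eventually_atTop.2 ⟨max r 1, fun R hR => key r hr R hR⟩)
    have hge : 0 ≤ ∫ z in closedBall (0 : ℂ) r, F z :=
      setIntegral_nonneg measurableSet_closedBall fun z _ => hF z
    linarith
  -- and `F` vanishes identically, by continuity
  set r : ℝ := ‖z₀‖ + 1 with hr
  have hr0 : 0 < r := by positivity
  have hae : F =ᵐ[volume.restrict (closedBall (0 : ℂ) r)] 0 :=
    (setIntegral_eq_zero_iff_of_nonneg_ae (Eventually.of_forall fun z => hF z)
      (hF_int _ (isCompact_closedBall 0 r))).1 (hzero r hr0)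
  have hEq : EqOn F 0 (ball (0 : ℂ) r) :=
    Measure.eqOn_open_of_ae_eq (ae_restrict_of_ae_restrict_of_subset ball_subset_closedBall hae)
      isOpen_ball hFc.continuousOn continuousOn_const
  exact hEq (mem_ball_zero_iff.2 (by linarith [norm_nonneg z₀]))

end Flat

end Literature.Geometry.Symplectic
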